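import Summits.ResolutionOfSingularities.ResolutionOfSingularities.Theorems.PurelyInseparableDim4ResConeBInfEntryFrame
import Summits.ResolutionOfSingularities.ResolutionOfSingularities.Theorems.PurelyInseparableDim4ResConeBInfPotential
import Summits.ResolutionOfSingularities.ResolutionOfSingularities.Theorems.PurelyInseparableDim4ResConeBInfKeepStep
import Summits.ResolutionOfSingularities.ResolutionOfSingularities.Theorems.PurelyInseparableDim4ResConeBInfLoseStep
import Summits.ResolutionOfSingularities.ResolutionOfSingularities.Theorems.PurelyInseparableDim4ResConeLightTail
import HarnessLib
import HarnessLib.Audit.Tags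

/-!
# Purely inseparable four-folds — THE B∞ ASSEMBLY at `(p, d) = (5, 3)`, INSTANTIATED: the holder's potential-form assembly
# with datum = (critical letter, frame, inverse), `E`/`R` = the entry/run invariants, `Φ = betaS`, and the entry law E discharged
# (K2(p) lane, slice C `(5,3)`, memo §17 (R4); cell `res-dim4-pi`)

[OURS · counted 0 · cell `res-dim4-pi` · the assembly is the K2(p) lane holder res-dim4-p-12 g4's
`…ResConeBInfPotential.no_bInf_tail_of_potential` (abstract datum `Fr`, predicates `E R`, potential `Φ`); this file is its
INSTANTIATION with the skeleton-v2 (`BInf-ASSEMBLY-SKELETON.lean` b10e0a76a4b9b1eb) invariants UNFOLDED: `Fr := Fin 4 × (frame ×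
inverse)`, `E := EntryInv`, `R := RunInv = EntryInv ∧ 0 < αs`, `Φ := betaS` of `(G_k / 1)` in the frame of `𝒪 = K[x]_{(x)}`; the
ENTRY law `hE` is DISCHARGED by `…ResConeBInfEntryFrame.stub_entryFrame` (res-dim4-p-9 g4, p702794); the two STEP laws enter as
the NAMED HYPOTHESES `hK` (KEEP, res-dim4-p-7 g4's `stub_keep`) and `hL` (LOSE, res-dim4-p-2 g5's `stub_lose`), character-for-character
the skeleton-v2 stubs — the unconditional headline is their one-line instantiation when they land; seat res-dim4-p-9 g4.]
Nothing here proves K2(p)/K2(5), `NoIsolatedTrap p p`, the β_h line, or resolution of singularities in dimension ≥ 4 /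
characteristic `p`.  AI kernel work, weaker than expert review.

* **`no_bInf_tail_three_five_of_KL`** — TAIL-B data, heavy branch from `k₁`, `hK`, `hL` ⇒ False;
* **`tailB_three_five_of_KL_of_light`** — with a kill of the LIGHT branch `(1,1,1)` (loss-free part ✓ `no_lossfree_tail`; LOSSY
  LIGHT = the located gap of memo §17): the `(5,3)` block of the slice-C socket, modulo `hK`, `hL`;
* APPEND (after STUB K / STUB L landed): **`no_bInf_tail_three_five`** (heavy branch EMPTY, unconditional) and
  **`tailB_three_five_of_light`** (TAIL-B modulo the light-branch kill only).
[cite: CossartJannsenSaito2020, Lemma 12.1 (3), Lemma 13.4 (3)] [cite: CossartPiltant2008, (16)]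
bears_on: LADDER-RESOLUTION:D157-DOOR2 (res-dim4-pi · K2(p) · slice C (5,3) B∞ assembly, instantiated).  Supports
stmt-ResolutionOfSingularities-16155 (helper).
-/

set_option linter.dupNamespace false -- mandated namespace of this single-conjunct summit

noncomputable section

namespace Summit.ResolutionOfSingularities.ResolutionOfSingularities.Theorems.PIDim4

namespace ResCone

open MvPolynomial Finset IsLocalRing
open Literature.AlgebraicGeometry.Resolution
open Literature.AlgebraicGeometry.Resolution.CentreBlowup
open Literature.AlgebraicGeometry.Resolution.Hauser2010
open Literature.AlgebraicGeometry.Resolution.HauserPerlega2019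
open Literature.AlgebraicGeometry.Resolution.WeightedOrder

variable {K : Type} [Field K] [CharP K 5] [DecidableEq K]

/-- **THE B∞ ASSEMBLY, INSTANTIATED, MODULO THE TWO STEP LAWS.**  On TAIL-B data (isolated witnessed `Step0 5` chain,
`x^{r₀} ∣ F₀`, off the floor, shade `3` and `e_G = 2` from `k₀`) in the heavy branch from `k₁ ≥ k₀` (a weight-`2` letter at every
state), ASSUMING the KEEP law `hK` (skeleton-v2 `stub_keep`: at a P-state a run-invariant frame passes to the child, same critical
letter, `betaS` strictly smaller) and the LOSE law `hL` (skeleton-v2 `stub_lose`: at a Q-state an entry-invariant frame passes to a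
run-invariant frame of the child with critical letter `j k`, `betaS` not larger) — both with `EntryInv`/`RunInv` UNFOLDED over the
frame `(Σ_t L_{i t} x_t / 1)_i` and the ideal `(G_k / 1)`, `μ = 3` — the chain cannot exist: the holder's
`no_bInf_tail_of_potential` with `E := EntryInv`, `R := RunInv`, `Φ := betaS`, the entry law being `stub_entryFrame`. [OURS]
[cite: CossartJannsenSaito2020, Lemma 13.4 (3)] [cite: CossartPiltant2008, (16)] -/
theorem no_bInf_tail_three_five_of_KL {c : ℕ → State K} {j : ℕ → Fin 4} {b : ℕ → Fin 4 → K}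
    (hc : ∀ k, IsIsolated 5 (c k).F ∧ Step0 5 (c k) (c (k + 1))) (hw : FreeTail.IsWitnessedChain 5 c j b)
    (hr0 : ∀ e ∈ (c 0).F.support, (c 0).r ≤ e) (hfloor : ∀ k, ordZero (c k).F ≠ 5) {k₀ : ℕ}
    (hshade : ∀ k, k₀ ≤ k → (c k).shade = ((3 : ℕ) : ℕ∞))
    (he : ∀ k, k₀ ≤ k → Module.finrank K (resVertex (c k)) = 2)
    (hK : ∀ k, k₀ ≤ k → (c k).r.degree = 3 → ∀ (h : Fin 4) (L : Fin (2 + 2) → Fin 4 → K) (M : Fin 4 → Fin (2 + 2) → K),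
      ((∀ t u, ∑ i, M t i * L i u = if t = u then 1 else 0) ∧ L (u1 2) = Pi.single h 1 ∧
        (∀ i, i ≠ u1 2 → i ≠ u2 2 → ∀ w ∈ resVertex (c k), ∑ t, L i t * w t = 0) ∧ (c k).r h = 2 ∧
        (pts (fun i => algebraMap (MvPolynomial (Fin 4) K) (OriginLocalization K 4) (∑ t, C (L i t) * X t))
          (Ideal.span {algebraMap (MvPolynomial (Fin 4) K) (OriginLocalization K 4)
            ((c k).F.divMonomial (c k).r)}) 3).Nonempty ∧
        Nat.factorial 3 < deltaS (fun i => algebraMap (MvPolynomial (Fin 4) K) (OriginLocalization K 4)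
          (∑ t, C (L i t) * X t)) (Ideal.span {algebraMap (MvPolynomial (Fin 4) K) (OriginLocalization K 4)
            ((c k).F.divMonomial (c k).r)}) 3 ∧
        alphaS (fun i => algebraMap (MvPolynomial (Fin 4) K) (OriginLocalization K 4) (∑ t, C (L i t) * X t))
          (Ideal.span {algebraMap (MvPolynomial (Fin 4) K) (OriginLocalization K 4)
            ((c k).F.divMonomial (c k).r)}) 3 < Nat.factorial 3) ∧
      0 < alphaS (fun i => algebraMap (MvPolynomial (Fin 4) K) (OriginLocalization K 4) (∑ t, C (L i t) * X t))
          (Ideal.span {algebraMap (MvPolynomial (Fin 4) K) (OriginLocalization K 4)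
            ((c k).F.divMonomial (c k).r)}) 3 →
      ∃ (L' : Fin (2 + 2) → Fin 4 → K) (M' : Fin 4 → Fin (2 + 2) → K),
        (((∀ t u, ∑ i, M' t i * L' i u = if t = u then 1 else 0) ∧ L' (u1 2) = Pi.single h 1 ∧
          (∀ i, i ≠ u1 2 → i ≠ u2 2 → ∀ w ∈ resVertex (c (k + 1)), ∑ t, L' i t * w t = 0) ∧ (c (k + 1)).r h = 2 ∧
          (pts (fun i => algebraMap (MvPolynomial (Fin 4) K) (OriginLocalization K 4) (∑ t, C (L' i t) * X t))
            (Ideal.span {algebraMap (MvPolynomial (Fin 4) K) (OriginLocalization K 4)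
              ((c (k + 1)).F.divMonomial (c (k + 1)).r)}) 3).Nonempty ∧
          Nat.factorial 3 < deltaS (fun i => algebraMap (MvPolynomial (Fin 4) K) (OriginLocalization K 4)
            (∑ t, C (L' i t) * X t)) (Ideal.span {algebraMap (MvPolynomial (Fin 4) K) (OriginLocalization K 4)
              ((c (k + 1)).F.divMonomial (c (k + 1)).r)}) 3 ∧
          alphaS (fun i => algebraMap (MvPolynomial (Fin 4) K) (OriginLocalization K 4) (∑ t, C (L' i t) * X t))
            (Ideal.span {algebraMap (MvPolynomial (Fin 4) K) (OriginLocalization K 4)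
              ((c (k + 1)).F.divMonomial (c (k + 1)).r)}) 3 < Nat.factorial 3) ∧
        0 < alphaS (fun i => algebraMap (MvPolynomial (Fin 4) K) (OriginLocalization K 4) (∑ t, C (L' i t) * X t))
            (Ideal.span {algebraMap (MvPolynomial (Fin 4) K) (OriginLocalization K 4)
              ((c (k + 1)).F.divMonomial (c (k + 1)).r)}) 3) ∧
        betaS (fun i => algebraMap (MvPolynomial (Fin 4) K) (OriginLocalization K 4) (∑ t, C (L' i t) * X t))
            (Ideal.span {algebraMap (MvPolynomial (Fin 4) K) (OriginLocalization K 4)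
              ((c (k + 1)).F.divMonomial (c (k + 1)).r)}) 3 <
          betaS (fun i => algebraMap (MvPolynomial (Fin 4) K) (OriginLocalization K 4) (∑ t, C (L i t) * X t))
            (Ideal.span {algebraMap (MvPolynomial (Fin 4) K) (OriginLocalization K 4)
              ((c k).F.divMonomial (c k).r)}) 3)
    (hL : ∀ k, k₀ ≤ k → (c k).r.degree = 4 → ∀ (h : Fin 4) (L : Fin (2 + 2) → Fin 4 → K) (M : Fin 4 → Fin (2 + 2) → K),
      ((∀ t u, ∑ i, M t i * L i u = if t = u then 1 else 0) ∧ L (u1 2) = Pi.single h 1 ∧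
        (∀ i, i ≠ u1 2 → i ≠ u2 2 → ∀ w ∈ resVertex (c k), ∑ t, L i t * w t = 0) ∧ (c k).r h = 2 ∧
        (pts (fun i => algebraMap (MvPolynomial (Fin 4) K) (OriginLocalization K 4) (∑ t, C (L i t) * X t))
          (Ideal.span {algebraMap (MvPolynomial (Fin 4) K) (OriginLocalization K 4)
            ((c k).F.divMonomial (c k).r)}) 3).Nonempty ∧
        Nat.factorial 3 < deltaS (fun i => algebraMap (MvPolynomial (Fin 4) K) (OriginLocalization K 4)
          (∑ t, C (L i t) * X t)) (Ideal.span {algebraMap (MvPolynomial (Fin 4) K) (OriginLocalization K 4)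
            ((c k).F.divMonomial (c k).r)}) 3 ∧
        alphaS (fun i => algebraMap (MvPolynomial (Fin 4) K) (OriginLocalization K 4) (∑ t, C (L i t) * X t))
          (Ideal.span {algebraMap (MvPolynomial (Fin 4) K) (OriginLocalization K 4)
            ((c k).F.divMonomial (c k).r)}) 3 < Nat.factorial 3) →
      ∃ (L' : Fin (2 + 2) → Fin 4 → K) (M' : Fin 4 → Fin (2 + 2) → K),
        (((∀ t u, ∑ i, M' t i * L' i u = if t = u then 1 else 0) ∧ L' (u1 2) = Pi.single (j k) 1 ∧
          (∀ i, i ≠ u1 2 → i ≠ u2 2 → ∀ w ∈ resVertex (c (k + 1)), ∑ t, L' i t * w t = 0) ∧ (c (k + 1)).r (j k) = 2 ∧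
          (pts (fun i => algebraMap (MvPolynomial (Fin 4) K) (OriginLocalization K 4) (∑ t, C (L' i t) * X t))
            (Ideal.span {algebraMap (MvPolynomial (Fin 4) K) (OriginLocalization K 4)
              ((c (k + 1)).F.divMonomial (c (k + 1)).r)}) 3).Nonempty ∧
          Nat.factorial 3 < deltaS (fun i => algebraMap (MvPolynomial (Fin 4) K) (OriginLocalization K 4)
            (∑ t, C (L' i t) * X t)) (Ideal.span {algebraMap (MvPolynomial (Fin 4) K) (OriginLocalization K 4)
              ((c (k + 1)).F.divMonomial (c (k + 1)).r)}) 3 ∧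
          alphaS (fun i => algebraMap (MvPolynomial (Fin 4) K) (OriginLocalization K 4) (∑ t, C (L' i t) * X t))
            (Ideal.span {algebraMap (MvPolynomial (Fin 4) K) (OriginLocalization K 4)
              ((c (k + 1)).F.divMonomial (c (k + 1)).r)}) 3 < Nat.factorial 3) ∧
        0 < alphaS (fun i => algebraMap (MvPolynomial (Fin 4) K) (OriginLocalization K 4) (∑ t, C (L' i t) * X t))
            (Ideal.span {algebraMap (MvPolynomial (Fin 4) K) (OriginLocalization K 4)
              ((c (k + 1)).F.divMonomial (c (k + 1)).r)}) 3) ∧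
        betaS (fun i => algebraMap (MvPolynomial (Fin 4) K) (OriginLocalization K 4) (∑ t, C (L' i t) * X t))
            (Ideal.span {algebraMap (MvPolynomial (Fin 4) K) (OriginLocalization K 4)
              ((c (k + 1)).F.divMonomial (c (k + 1)).r)}) 3 ≤
          betaS (fun i => algebraMap (MvPolynomial (Fin 4) K) (OriginLocalization K 4) (∑ t, C (L i t) * X t))
            (Ideal.span {algebraMap (MvPolynomial (Fin 4) K) (OriginLocalization K 4)
              ((c k).F.divMonomial (c k).r)}) 3)
    {k₁ : ℕ} (hk₁ : k₀ ≤ k₁) (hheavy : ∀ k, k₁ ≤ k → ∃ W, (c k).r W = 2) : False := by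
  -- datum = (critical letter, frame, inverse); `E` = EntryInv, `R` = RunInv, `Φ` = betaS
  refine no_bInf_tail_of_potential hc hw hr0 hfloor hshade hk₁ hheavy
    (Fr := Fin 4 × ((Fin (2 + 2) → Fin 4 → K) × (Fin 4 → Fin (2 + 2) → K)))
    (fun k f =>
      (∀ t u, ∑ i, f.2.2 t i * f.2.1 i u = if t = u then 1 else 0) ∧ f.2.1 (u1 2) = Pi.single f.1 1 ∧
        (∀ i, i ≠ u1 2 → i ≠ u2 2 → ∀ w ∈ resVertex (c k), ∑ t, f.2.1 i t * w t = 0) ∧ (c k).r f.1 = 2 ∧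
        (pts (fun i => algebraMap (MvPolynomial (Fin 4) K) (OriginLocalization K 4) (∑ t, C (f.2.1 i t) * X t))
          (Ideal.span {algebraMap (MvPolynomial (Fin 4) K) (OriginLocalization K 4)
            ((c k).F.divMonomial (c k).r)}) 3).Nonempty ∧
        Nat.factorial 3 < deltaS (fun i => algebraMap (MvPolynomial (Fin 4) K) (OriginLocalization K 4)
          (∑ t, C (f.2.1 i t) * X t)) (Ideal.span {algebraMap (MvPolynomial (Fin 4) K) (OriginLocalization K 4)
            ((c k).F.divMonomial (c k).r)}) 3 ∧
        alphaS (fun i => algebraMap (MvPolynomial (Fin 4) K) (OriginLocalization K 4) (∑ t, C (f.2.1 i t) * X t))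
          (Ideal.span {algebraMap (MvPolynomial (Fin 4) K) (OriginLocalization K 4)
            ((c k).F.divMonomial (c k).r)}) 3 < Nat.factorial 3)
    (fun k f =>
      ((∀ t u, ∑ i, f.2.2 t i * f.2.1 i u = if t = u then 1 else 0) ∧ f.2.1 (u1 2) = Pi.single f.1 1 ∧
        (∀ i, i ≠ u1 2 → i ≠ u2 2 → ∀ w ∈ resVertex (c k), ∑ t, f.2.1 i t * w t = 0) ∧ (c k).r f.1 = 2 ∧
        (pts (fun i => algebraMap (MvPolynomial (Fin 4) K) (OriginLocalization K 4) (∑ t, C (f.2.1 i t) * X t))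
          (Ideal.span {algebraMap (MvPolynomial (Fin 4) K) (OriginLocalization K 4)
            ((c k).F.divMonomial (c k).r)}) 3).Nonempty ∧
        Nat.factorial 3 < deltaS (fun i => algebraMap (MvPolynomial (Fin 4) K) (OriginLocalization K 4)
          (∑ t, C (f.2.1 i t) * X t)) (Ideal.span {algebraMap (MvPolynomial (Fin 4) K) (OriginLocalization K 4)
            ((c k).F.divMonomial (c k).r)}) 3 ∧
        alphaS (fun i => algebraMap (MvPolynomial (Fin 4) K) (OriginLocalization K 4) (∑ t, C (f.2.1 i t) * X t))
          (Ideal.span {algebraMap (MvPolynomial (Fin 4) K) (OriginLocalization K 4)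
            ((c k).F.divMonomial (c k).r)}) 3 < Nat.factorial 3) ∧
      0 < alphaS (fun i => algebraMap (MvPolynomial (Fin 4) K) (OriginLocalization K 4) (∑ t, C (f.2.1 i t) * X t))
          (Ideal.span {algebraMap (MvPolynomial (Fin 4) K) (OriginLocalization K 4)
            ((c k).F.divMonomial (c k).r)}) 3)
    (fun k f => betaS (fun i => algebraMap (MvPolynomial (Fin 4) K) (OriginLocalization K 4)
        (∑ t, C (f.2.1 i t) * X t)) (Ideal.span {algebraMap (MvPolynomial (Fin 4) K) (OriginLocalization K 4)
          ((c k).F.divMonomial (c k).r)}) 3)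
    ?_ ?_ ?_ (fun _ _ hR => hR.1)
  · -- E: the entry frame (STUB E)
    intro k hk h4
    obtain ⟨W, hW⟩ := hheavy k hk
    obtain ⟨L, M, hE⟩ := stub_entryFrame hc hw hr0 hfloor hshade he (by omega) h4 hW
    exact ⟨⟨W, L, M⟩, hE⟩
  · -- L: the LOSE law
    rintro k hk h4 ⟨h, L, M⟩ hE
    obtain ⟨L', M', hR', hle⟩ := hL k (by omega) h4 h L M hE
    exact ⟨⟨j k, L', M'⟩, hR', hle⟩
  · -- K: the KEEP law
    rintro k hk h3 ⟨h, L, M⟩ hR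
    obtain ⟨L', M', hR', hlt⟩ := hK k (by omega) h3 h L M hR
    exact ⟨⟨h, L', M'⟩, hR', hlt⟩

omit [CharP K 5] [DecidableEq K] in
/-- The heavy branch of W's dichotomy has a weight-`2` letter at every state. [folklore] -/
theorem heavy_of_dichotomy {c : ℕ → State K} {k₁ : ℕ}
    (hB : ∀ k, k₁ ≤ k → (∃ W, (c k).r W = 2 ∧ ∀ i, i ≠ W → (c k).r i ≤ 1) ∧
      (3 ≤ (c k).r.degree ∧ (c k).r.degree ≤ 4)) :
    ∀ k, k₁ ≤ k → ∃ W, (c k).r W = 2 := fun k hk => by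
  obtain ⟨⟨W, hW, -⟩, -⟩ := hB k hk
  exact ⟨W, hW⟩

/-- **TAIL-B AT `(5,3)` MODULO THE TWO STEP LAWS AND THE LIGHT-BRANCH KILL** (holder's `tailB_of_stubs_of_light`, instantiated):
on TAIL-B data, W's `three_weights_dichotomy` splits the tail into the LIGHT branch (`(1,1,1)` for ever — killed by `hlight`;
loss-free part ✓ `no_lossfree_tail`, LOSSY LIGHT = the located gap of memo §17 / hN4-C) and the HEAVY branch (killed by
`no_bInf_tail_three_five_of_KL`).  This is the `d = 3` block of `…ResConeSliceCSocket` modulo `hK`, `hL`, `hlight`. [OURS]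
[cite: CossartJannsenSaito2020, Lemma 13.4 (3)] [cite: CossartPiltant2008, (16)] -/
theorem tailB_three_five_of_KL_of_light {c : ℕ → State K} {j : ℕ → Fin 4} {b : ℕ → Fin 4 → K}
    (hc : ∀ k, IsIsolated 5 (c k).F ∧ Step0 5 (c k) (c (k + 1))) (hw : FreeTail.IsWitnessedChain 5 c j b)
    (hr0 : ∀ e ∈ (c 0).F.support, (c 0).r ≤ e) (hfloor : ∀ k, ordZero (c k).F ≠ (5 : ℕ)) {k₀ : ℕ}
    (hshade : ∀ k, k₀ ≤ k → (c k).shade = ((3 : ℕ) : ℕ∞))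
    (he : ∀ k, k₀ ≤ k → Module.finrank K (resVertex (c k)) = 2)
    (hlight : (∀ k, k₀ ≤ k → (∀ i, (c k).r i ≤ 1) ∧ (c k).r.degree = 3) → False)
    (hK : ∀ k, k₀ ≤ k → (c k).r.degree = 3 → ∀ (h : Fin 4) (L : Fin (2 + 2) → Fin 4 → K) (M : Fin 4 → Fin (2 + 2) → K),
      ((∀ t u, ∑ i, M t i * L i u = if t = u then 1 else 0) ∧ L (u1 2) = Pi.single h 1 ∧
        (∀ i, i ≠ u1 2 → i ≠ u2 2 → ∀ w ∈ resVertex (c k), ∑ t, L i t * w t = 0) ∧ (c k).r h = 2 ∧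
        (pts (fun i => algebraMap (MvPolynomial (Fin 4) K) (OriginLocalization K 4) (∑ t, C (L i t) * X t))
          (Ideal.span {algebraMap (MvPolynomial (Fin 4) K) (OriginLocalization K 4)
            ((c k).F.divMonomial (c k).r)}) 3).Nonempty ∧
        Nat.factorial 3 < deltaS (fun i => algebraMap (MvPolynomial (Fin 4) K) (OriginLocalization K 4)
          (∑ t, C (L i t) * X t)) (Ideal.span {algebraMap (MvPolynomial (Fin 4) K) (OriginLocalization K 4)
            ((c k).F.divMonomial (c k).r)}) 3 ∧
        alphaS (fun i => algebraMap (MvPolynomial (Fin 4) K) (OriginLocalization K 4) (∑ t, C (L i t) * X t))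
          (Ideal.span {algebraMap (MvPolynomial (Fin 4) K) (OriginLocalization K 4)
            ((c k).F.divMonomial (c k).r)}) 3 < Nat.factorial 3) ∧
      0 < alphaS (fun i => algebraMap (MvPolynomial (Fin 4) K) (OriginLocalization K 4) (∑ t, C (L i t) * X t))
          (Ideal.span {algebraMap (MvPolynomial (Fin 4) K) (OriginLocalization K 4)
            ((c k).F.divMonomial (c k).r)}) 3 →
      ∃ (L' : Fin (2 + 2) → Fin 4 → K) (M' : Fin 4 → Fin (2 + 2) → K),
        (((∀ t u, ∑ i, M' t i * L' i u = if t = u then 1 else 0) ∧ L' (u1 2) = Pi.single h 1 ∧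
          (∀ i, i ≠ u1 2 → i ≠ u2 2 → ∀ w ∈ resVertex (c (k + 1)), ∑ t, L' i t * w t = 0) ∧ (c (k + 1)).r h = 2 ∧
          (pts (fun i => algebraMap (MvPolynomial (Fin 4) K) (OriginLocalization K 4) (∑ t, C (L' i t) * X t))
            (Ideal.span {algebraMap (MvPolynomial (Fin 4) K) (OriginLocalization K 4)
              ((c (k + 1)).F.divMonomial (c (k + 1)).r)}) 3).Nonempty ∧
          Nat.factorial 3 < deltaS (fun i => algebraMap (MvPolynomial (Fin 4) K) (OriginLocalization K 4)
            (∑ t, C (L' i t) * X t)) (Ideal.span {algebraMap (MvPolynomial (Fin 4) K) (OriginLocalization K 4)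
              ((c (k + 1)).F.divMonomial (c (k + 1)).r)}) 3 ∧
          alphaS (fun i => algebraMap (MvPolynomial (Fin 4) K) (OriginLocalization K 4) (∑ t, C (L' i t) * X t))
            (Ideal.span {algebraMap (MvPolynomial (Fin 4) K) (OriginLocalization K 4)
              ((c (k + 1)).F.divMonomial (c (k + 1)).r)}) 3 < Nat.factorial 3) ∧
        0 < alphaS (fun i => algebraMap (MvPolynomial (Fin 4) K) (OriginLocalization K 4) (∑ t, C (L' i t) * X t))
            (Ideal.span {algebraMap (MvPolynomial (Fin 4) K) (OriginLocalization K 4)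
              ((c (k + 1)).F.divMonomial (c (k + 1)).r)}) 3) ∧
        betaS (fun i => algebraMap (MvPolynomial (Fin 4) K) (OriginLocalization K 4) (∑ t, C (L' i t) * X t))
            (Ideal.span {algebraMap (MvPolynomial (Fin 4) K) (OriginLocalization K 4)
              ((c (k + 1)).F.divMonomial (c (k + 1)).r)}) 3 <
          betaS (fun i => algebraMap (MvPolynomial (Fin 4) K) (OriginLocalization K 4) (∑ t, C (L i t) * X t))
            (Ideal.span {algebraMap (MvPolynomial (Fin 4) K) (OriginLocalization K 4)
              ((c k).F.divMonomial (c k).r)}) 3)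
    (hL : ∀ k, k₀ ≤ k → (c k).r.degree = 4 → ∀ (h : Fin 4) (L : Fin (2 + 2) → Fin 4 → K) (M : Fin 4 → Fin (2 + 2) → K),
      ((∀ t u, ∑ i, M t i * L i u = if t = u then 1 else 0) ∧ L (u1 2) = Pi.single h 1 ∧
        (∀ i, i ≠ u1 2 → i ≠ u2 2 → ∀ w ∈ resVertex (c k), ∑ t, L i t * w t = 0) ∧ (c k).r h = 2 ∧
        (pts (fun i => algebraMap (MvPolynomial (Fin 4) K) (OriginLocalization K 4) (∑ t, C (L i t) * X t))
          (Ideal.span {algebraMap (MvPolynomial (Fin 4) K) (OriginLocalization K 4)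
            ((c k).F.divMonomial (c k).r)}) 3).Nonempty ∧
        Nat.factorial 3 < deltaS (fun i => algebraMap (MvPolynomial (Fin 4) K) (OriginLocalization K 4)
          (∑ t, C (L i t) * X t)) (Ideal.span {algebraMap (MvPolynomial (Fin 4) K) (OriginLocalization K 4)
            ((c k).F.divMonomial (c k).r)}) 3 ∧
        alphaS (fun i => algebraMap (MvPolynomial (Fin 4) K) (OriginLocalization K 4) (∑ t, C (L i t) * X t))
          (Ideal.span {algebraMap (MvPolynomial (Fin 4) K) (OriginLocalization K 4)
            ((c k).F.divMonomial (c k).r)}) 3 < Nat.factorial 3) →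
      ∃ (L' : Fin (2 + 2) → Fin 4 → K) (M' : Fin 4 → Fin (2 + 2) → K),
        (((∀ t u, ∑ i, M' t i * L' i u = if t = u then 1 else 0) ∧ L' (u1 2) = Pi.single (j k) 1 ∧
          (∀ i, i ≠ u1 2 → i ≠ u2 2 → ∀ w ∈ resVertex (c (k + 1)), ∑ t, L' i t * w t = 0) ∧ (c (k + 1)).r (j k) = 2 ∧
          (pts (fun i => algebraMap (MvPolynomial (Fin 4) K) (OriginLocalization K 4) (∑ t, C (L' i t) * X t))
            (Ideal.span {algebraMap (MvPolynomial (Fin 4) K) (OriginLocalization K 4)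
              ((c (k + 1)).F.divMonomial (c (k + 1)).r)}) 3).Nonempty ∧
          Nat.factorial 3 < deltaS (fun i => algebraMap (MvPolynomial (Fin 4) K) (OriginLocalization K 4)
            (∑ t, C (L' i t) * X t)) (Ideal.span {algebraMap (MvPolynomial (Fin 4) K) (OriginLocalization K 4)
              ((c (k + 1)).F.divMonomial (c (k + 1)).r)}) 3 ∧
          alphaS (fun i => algebraMap (MvPolynomial (Fin 4) K) (OriginLocalization K 4) (∑ t, C (L' i t) * X t))
            (Ideal.span {algebraMap (MvPolynomial (Fin 4) K) (OriginLocalization K 4)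
              ((c (k + 1)).F.divMonomial (c (k + 1)).r)}) 3 < Nat.factorial 3) ∧
        0 < alphaS (fun i => algebraMap (MvPolynomial (Fin 4) K) (OriginLocalization K 4) (∑ t, C (L' i t) * X t))
            (Ideal.span {algebraMap (MvPolynomial (Fin 4) K) (OriginLocalization K 4)
              ((c (k + 1)).F.divMonomial (c (k + 1)).r)}) 3) ∧
        betaS (fun i => algebraMap (MvPolynomial (Fin 4) K) (OriginLocalization K 4) (∑ t, C (L' i t) * X t))
            (Ideal.span {algebraMap (MvPolynomial (Fin 4) K) (OriginLocalization K 4)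
              ((c (k + 1)).F.divMonomial (c (k + 1)).r)}) 3 ≤
          betaS (fun i => algebraMap (MvPolynomial (Fin 4) K) (OriginLocalization K 4) (∑ t, C (L i t) * X t))
            (Ideal.span {algebraMap (MvPolynomial (Fin 4) K) (OriginLocalization K 4)
              ((c k).F.divMonomial (c k).r)}) 3)
    : False := by
  have hfloor' : ∀ k, ordZero (c k).F ≠ 5 := fun k => by exact_mod_cast hfloor k
  rcases three_weights_dichotomy hc hw hr0 hfloor' hshade with hlt | ⟨k₁, hk₁, hB⟩
  · exact hlight hlt
  · exact no_bInf_tail_three_five_of_KL hc hw hr0 hfloor' hshade he hK hL hk₁ (heavy_of_dichotomy hB)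

/-! ## The unconditional theorems (APPEND 2026-08-29 ≈07:10Z, after STUB K p704534 and STUB L landed)

The two step laws are now tree theorems: `ResCone.stub_keep` (res-dim4-p-7 g4, `…ResConeBInfKeepStep`) and
`ResCone.bInf_stub_lose` (res-dim4-p-2 g5, `…ResConeBInfLoseStep`, the skeleton-shape projection of `bInf_lose_step`).  Plugging
them into `no_bInf_tail_three_five_of_KL` / `tailB_three_five_of_KL_of_light`: -/

/-- **NO B∞ TAIL AT `(p, d) = (5, 3)`** — the HEAVY branch of TAIL-B is EMPTY, unconditionally: an isolated witnessed above-floor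
`Step0 5` chain with `x^{r₀} ∣ F₀`, shade `3` and `e_G = 2` from `k₀`, and a weight-`2` letter at every state from some `k₁ ≥ k₀`,
does not exist.  (= `no_bInf_tail_three_five_of_KL` with K := `stub_keep` (res-dim4-p-7 g4) and L := `bInf_stub_lose` (res-dim4-p-2
g5); E = `stub_entryFrame`, A = the holder's `no_bInf_tail_of_potential`, W/W′ the weight automaton — memo §17 (R1)–(R5) of the K2(p)
lane, β_h line of res-dim4-idea-1, dictionary of res-dim4-p-11.) [OURS] [cite: CossartJannsenSaito2020, Lemma 12.1 (3), Lemma 13.4 (3)]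
[cite: CossartPiltant2008, (16)] -/
theorem no_bInf_tail_three_five {c : ℕ → State K} {j : ℕ → Fin 4} {b : ℕ → Fin 4 → K}
    (hc : ∀ k, IsIsolated 5 (c k).F ∧ Step0 5 (c k) (c (k + 1))) (hw : FreeTail.IsWitnessedChain 5 c j b)
    (hr0 : ∀ e ∈ (c 0).F.support, (c 0).r ≤ e) (hfloor : ∀ k, ordZero (c k).F ≠ 5) {k₀ : ℕ}
    (hshade : ∀ k, k₀ ≤ k → (c k).shade = ((3 : ℕ) : ℕ∞))
    (he : ∀ k, k₀ ≤ k → Module.finrank K (resVertex (c k)) = 2)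
    {k₁ : ℕ} (hk₁ : k₀ ≤ k₁) (hheavy : ∀ k, k₁ ≤ k → ∃ W, (c k).r W = 2) : False :=
  no_bInf_tail_three_five_of_KL hc hw hr0 hfloor hshade he
    (fun _ hk h3 _ _ _ hinv => stub_keep hc hw hr0 hfloor hshade he hk h3 hinv)
    (bInf_stub_lose hc hw hr0 hfloor hshade he) hk₁ hheavy

/-- **TAIL-B AT `(5,3)` MODULO THE LIGHT-BRANCH KILL ONLY**: on TAIL-B data (shade `3`, `e_G = 2`), a kill of the LIGHT branch
(`(1,1,1)` for ever; loss-free part ✓ `no_lossfree_tail`, LOSSY LIGHT = the presentation residual hN4-C of memo §17, res-dim4-p-1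
lineage) gives `False` — the heavy branch being `no_bInf_tail_three_five`.  This is the `d = 3` block of `…ResConeSliceCSocket`
up to `hlight`. [OURS] [cite: CossartJannsenSaito2020, Lemma 13.4 (3)] -/
theorem tailB_three_five_of_light {c : ℕ → State K} {j : ℕ → Fin 4} {b : ℕ → Fin 4 → K}
    (hc : ∀ k, IsIsolated 5 (c k).F ∧ Step0 5 (c k) (c (k + 1))) (hw : FreeTail.IsWitnessedChain 5 c j b)
    (hr0 : ∀ e ∈ (c 0).F.support, (c 0).r ≤ e) (hfloor : ∀ k, ordZero (c k).F ≠ (5 : ℕ)) {k₀ : ℕ}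
    (hshade : ∀ k, k₀ ≤ k → (c k).shade = ((3 : ℕ) : ℕ∞))
    (he : ∀ k, k₀ ≤ k → Module.finrank K (resVertex (c k)) = 2)
    (hlight : (∀ k, k₀ ≤ k → (∀ i, (c k).r i ≤ 1) ∧ (c k).r.degree = 3) → False) : False := by
  have hfloor' : ∀ k, ordZero (c k).F ≠ 5 := fun k => by exact_mod_cast hfloor k
  rcases three_weights_dichotomy hc hw hr0 hfloor' hshade with hlt | ⟨k₁, hk₁, hB⟩
  · exact hlight hlt
  · exact no_bInf_tail_three_five hc hw hr0 hfloor' hshade he hk₁ (heavy_of_dichotomy hB)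

/-! ## TAIL-B at `(5,3)`, unconditionally (APPEND ≈07:35Z, after res-dim4-p-1 g5's light-branch kill p705856) -/

/-- **TAIL-B AT `(p, d) = (5, 3)` IS EMPTY, UNCONDITIONALLY**: there is no isolated witnessed above-floor `Step0 5` chain with
`x^{r₀} ∣ F₀`, constant shade `3` and `e_G = 2` from some index on — the HEAVY branch by `no_bInf_tail_three_five` (B∞: weights,
entry frame, Φ-line KEEP/LOSE laws, potential), the LIGHT branch by res-dim4-p-1 g5's `LightRep.no_light_tail_three_five` (loss-free
re-presentation + C13).  This is the `d = 3` block of `…ResConeSliceCSocket` with NO residual hypothesis. [OURS]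
[cite: CossartJannsenSaito2020, Thm. 3.14, Lemma 13.4 (3)] [cite: CossartPiltant2008, (16)] -/
theorem tailB_three_five {c : ℕ → State K} {j : ℕ → Fin 4} {b : ℕ → Fin 4 → K}
    (hc : ∀ k, IsIsolated 5 (c k).F ∧ Step0 5 (c k) (c (k + 1))) (hw : FreeTail.IsWitnessedChain 5 c j b)
    (hr0 : ∀ e ∈ (c 0).F.support, (c 0).r ≤ e) (hfloor : ∀ k, ordZero (c k).F ≠ (5 : ℕ)) {k₀ : ℕ}
    (hshade : ∀ k, k₀ ≤ k → (c k).shade = ((3 : ℕ) : ℕ∞))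
    (he : ∀ k, k₀ ≤ k → Module.finrank K (resVertex (c k)) = 2) : False :=
  tailB_three_five_of_light hc hw hr0 hfloor hshade he
    (LightRep.no_light_tail_three_five c j b hc hw hr0 hfloor k₀ hshade he)

end ResCone

end Summit.ResolutionOfSingularities.ResolutionOfSingularities.Theorems.PIDim4

end
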